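import Summits.KontsevichZagierPeriods.KontsevichZagierPeriods.Theses.HermiteRigidity
import Summits.KontsevichZagierPeriods.KontsevichZagierPeriods.Theorems.FurushoPentagonSectorToKernelCubeResolutionOfNash
import Literature.AlgebraicGeometry.Resolution.ProjectiveStrongResolution
import Literature.AlgebraicGeometry.RealAlgebraic.RealPointsManifold
import Literature.AlgebraicGeometry.Motives.AlgPointsProperMapProofs

/-!
# Crux idea `graph-closure-resolution-atlas` — first lemmas (crux `CubeResolution`, stmt-KontsevichZagierPeriods-17978; ideator r1 k2)

STAY BOUNDED, RESOLVE GRAPH CLOSURES, LET SCISSORS ABSORB THE OVERLAPS.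

The only geometric input of the line is `FiniteAnalyticAtlas d`: a bounded `ℚ`-semialgebraic map
`f`, analytic on a bounded open `ℚ`-semialgebraic `B ⊆ ℝᵈ`, is uniformized up to the boundary by
FINITELY many `ℚ`-Nash box charts `π_α : [0,1]ᵈ → ℝᵈ` (analytic on a neighbourhood of the closed box,
injective on an open semialgebraic `W_α` of the open box, images covering `B` a.e.), with `f ∘ π_α`
extending analytically to a neighbourhood of the closed box.  It is obtained from three theorems that
are PROVED in the tree (other summits' Literature):

* `Literature.AlgebraicGeometry.Resolution.exists_isResolution_isProjectiveOver_of_isProjectiveOver`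
  — Hironaka for integral projective varieties over ANY field of characteristic `0` (Kollár 2007
  Thm. 3.27 via marked ideals; axioms `propext/Classical.choice/Quot.sound`, re-checked this session),
  applied to the projective closure of the Zariski closure over `ℚ` of the graph of `f|_B`;
* `Literature.AlgebraicGeometry.RealAlgebraic.exists_chartedSpace_isManifold` — the real points of a
  smooth `ℚ`-scheme form a `C^ω` manifold whose charts have regular (polynomial, hence
  `ℚ`-semialgebraic) coordinates and in which regular functions are real-analytic;
* `Literature.AlgebraicGeometry.Motives.AlgPoints.isProperMap_map` — a proper morphism induces a
  proper map on `ℝ`-points (so the lift of the compact closure of the graph is compact ⇒ finitely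
  many closed boxes).

The rules side (`VolumeToFibreLengths`, `BoundedClassResolves`, `TameRegionResolves`) is an induction
on dimension using rule (3) ONCE (primitive `F = t` of the integrand `1`), rule (2) for triangular
cell charts and for the resolution charts on open pieces, and rule (1a) as INCLUSION–EXCLUSION over
the finite chart cover; every integrand that ever occurs is BOUNDED, so no monomialisation, no
integrability/exponent bookkeeping and no power substitution is needed.
-/

noncomputable section

set_option linter.dupNamespace false

namespace Summit.KontsevichZagierPeriods.KontsevichZagierPeriods.Cruxes.CubeResolution.IdeateR1K2

open Set MeasureTheory CategoryTheory
open Literature.ModelTheory.ExponentialFields (IsSemialgebraic)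
open Literature.NumberTheory.Transcendental
open Literature.NumberTheory.Transcendental.KZ hiding cubicalSpan cube
open Summit.KontsevichZagierPeriods.FurushoPentagon.ReducedPeriodRing (cubicalSpan)
open Summit.KontsevichZagierPeriods.KontsevichZagierPeriods.Theses.HermiteRigidity (CubeResolution)

/-- The open unit box `(0,1)ᵈ`. [folklore] -/
def openBox (d : ℕ) : Set (Fin d → ℝ) := {x | ∀ i, 0 < x i ∧ x i < 1}

/-- The closed unit box `[0,1]ᵈ` (= `KZ.cube d`). [folklore] -/
def closedBox (d : ℕ) : Set (Fin d → ℝ) := {x | ∀ i, 0 ≤ x i ∧ x i ≤ 1}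

/-- **FA_d — FINITE ANALYTIC ATLAS UP TO THE BOUNDARY** (the line's single geometric stub; a
consequence of the three proved tree theorems named in the module docstring).  For a bounded
`ℚ`-semialgebraic map `f : ℝᵈ → ℝᵏ` on a bounded open `ℚ`-semialgebraic `B` (no regularity asked: the
graph of `f|_B` is what gets resolved), there are
finitely many charts `π i` — `ℚ`-semialgebraic and real-analytic on a neighbourhood of the CLOSED box,
injective on an open `ℚ`-semialgebraic `W i ⊆ (0,1)ᵈ`, with `π i '' W i ⊆ B` — whose images cover `B`
up to a Lebesgue-null set, together with maps `g i`, analytic and `ℚ`-semialgebraic on a neighbourhood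
of the closed box, with `f ∘ π i = g i` on `W i`. [cite: Hironaka1964, Main Theorem I]
[cite: BochnakCosteRoy1998, Prop. 3.3.11] -/
def FiniteAnalyticAtlas (d : ℕ) : Prop :=
  ∀ (k : ℕ) (B : Set (Fin d → ℝ)) (f : (Fin d → ℝ) → (Fin k → ℝ)),
    IsSemialgebraic ℚ B → IsOpen B → Bornology.IsBounded B →
    IsSemialgebraicMapOn ℚ B f → Bornology.IsBounded (f '' B) →
    ∃ (ι : Type) (_ : Fintype ι) (π : ι → (Fin d → ℝ) → (Fin d → ℝ))
      (g : ι → (Fin d → ℝ) → (Fin k → ℝ)) (W : ι → Set (Fin d → ℝ)) (U : Set (Fin d → ℝ)),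
      IsOpen U ∧ closedBox d ⊆ U ∧
      (∀ i, IsSemialgebraicMapOn ℚ U (π i) ∧ AnalyticOnNhd ℝ (π i) U ∧
        IsSemialgebraicMapOn ℚ U (g i) ∧ AnalyticOnNhd ℝ (g i) U ∧
        IsSemialgebraic ℚ (W i) ∧ IsOpen (W i) ∧ W i ⊆ openBox d ∧ InjOn (π i) (W i) ∧
        π i '' W i ⊆ B ∧ EqOn (f ∘ π i) (g i) (W i)) ∧
      volume (B \ ⋃ i, π i '' W i) = 0

/-- **Step V — a bounded volume is a sum of fibre-length representations** (cylindrical decomposition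
of `K ⊆ ℝᵈ⁺¹` w.r.t. the last coordinate, rule (1a) across the cells, and ONE Newton–Leibniz move per
full-dimensional cell with primitive `F = t`: `[C, 1] ≡ [B_C, η_C − ξ_C]`; the fibre lengths
`η_C − ξ_C` are positive, BOUNDED and `ℚ`-semialgebraic on the open bounded base cell).
[cite: KontsevichZagier2001, §1.2 rules (1), (3)] [cite: BochnakCosteRoy1998, Thm. 2.3.6, Prop. 2.9.10] -/
def VolumeToFibreLengths (d : ℕ) : Prop :=
  ∀ (K : IntegralRep (d + 1)), Bornology.IsBounded K.domain → (∀ x ∈ K.domain, K.integrand x = 1) →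
    ∃ (S : ℕ) (s : Fin S → IntegralRep d),
      (∀ i, IsOpen (s i).domain ∧ Bornology.IsBounded (s i).domain ∧
        Bornology.IsBounded ((s i).integrand '' (s i).domain)) ∧
      of K - ∑ i, of (s i) ∈ relations

/-- **Bounded classes resolve**: `[B, g]` with `g` bounded and `ℚ`-semialgebraic on the bounded open
`ℚ`-semialgebraic `B ⊆ ℝᵈ` (the data of an `IntegralRep` with open bounded domain and bounded integrand)
is congruent to an element of the tame cubical span — from `FiniteAnalyticAtlas d` applied to the graph
of `g` (inclusion–exclusion over the chart images by rule (1a); pull back along each chart by rule (2)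
on the open piece `W i`; sign-split of the analytic Jacobian) and `TameRegionResolves d 0`.
[cite: KontsevichZagier2001, §1.2 rules (1), (2)] -/
def BoundedClassResolves (d : ℕ) : Prop :=
  ∀ (s : IntegralRep d), IsOpen s.domain → Bornology.IsBounded s.domain →
    Bornology.IsBounded (s.integrand '' s.domain) →
    ∃ c ∈ cubicalSpan, of s - c ∈ relations

/-- **TR(e, j) — tame regions cylindered by a box resolve**: `[R × (0,1)ʲ, G]`, `R ⊆ ℝᵉ` bounded open
`ℚ`-semialgebraic, `G` analytic and `ℚ`-semialgebraic on a neighbourhood of `closure R × [0,1]ʲ`, is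
congruent to an element of the tame cubical span.  Induction on `e`: `TR(0, j)` is a tame cube class
outright; `TR(e+1, j) ⇐ FiniteAnalyticAtlas e + TR(e, j+1)` (cells of `R` over bases in `ℝᵉ`, the
triangular chart `(y, u) ↦ (y, ξ' y + u (η' y − ξ' y))` as ONE rule-(2) move with bounded Jacobian
`η' − ξ'`, then the atlas for `(ξ', η')` on the base). [cite: KontsevichZagier2001, §1.2 rules (1), (2)] -/
def TameRegionResolves (e j : ℕ) : Prop :=
  ∀ (R : Set (Fin e → ℝ)) (U : Set (Fin (e + j) → ℝ)) (G : (Fin (e + j) → ℝ) → ℝ) (r : IntegralRep (e + j)),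
    IsSemialgebraic ℚ R → IsOpen R → Bornology.IsBounded R → IsOpen U →
    {z | (fun i => z (Fin.castAdd j i)) ∈ closure R ∧ (fun i => z (Fin.natAdd e i)) ∈ closedBox j} ⊆ U →
    AnalyticOnNhd ℝ G U → IsSemialgebraicFunOn ℚ U G →
    r.domain = {z | (fun i => z (Fin.castAdd j i)) ∈ R ∧ (fun i => z (Fin.natAdd e i)) ∈ openBox j} →
    EqOn r.integrand G r.domain →
    ∃ c ∈ cubicalSpan, of r - c ∈ relations

/-- The intended composition of the line (to be proved by the crux-plan seat; recorded as a `Prop` so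
that this sketch stays sorry-free): the crux BY NAME from the four statements, over the landed
`cubeResolution_of_boundedVolumes` (Viu-Sos). [cite: ViuSos2021, Thm. 1.1] -/
def LineShape : Prop :=
  (∀ d, FiniteAnalyticAtlas d) → (∀ d, VolumeToFibreLengths d) →
    (∀ e j, TameRegionResolves e j) → (∀ d, BoundedClassResolves d) → CubeResolution

/-- The last implication of the chain is already formal: bounded-volume resolution in every dimension
gives the crux (Viu-Sos, landed as `cubeResolution_of_boundedVolumes`). This is the shape the stubs
must feed. [cite: ViuSos2021, Thm. 1.1] -/
theorem cubeResolution_of_volumes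
    (h : ∀ (m : ℕ) (K : IntegralRep m), Bornology.IsBounded K.domain →
      (∀ x ∈ K.domain, K.integrand x = 1) → ∃ c : FormalRep, c ∈ cubicalSpan ∧ of K - c ∈ relations) :
    CubeResolution := by
  intro N u
  obtain ⟨c, hc, huc⟩ :=
    Summit.KontsevichZagierPeriods.FurushoPentagon.SectorToKernel.cubeResolution_of_boundedVolumes h N u
  exact ⟨c, hc, huc⟩

/-! ### The resolution input is a THEOREM of the tree (re-exported here to certify co-elaboration
with the KZ theses; all on axioms `propext`, `Classical.choice`, `Quot.sound`). -/

/-- Hironaka over any field of characteristic zero, projective form (Kollár 2007, Thm. 3.27), PROVED in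
`Literature/AlgebraicGeometry/Resolution/ProjectiveResolutionProofs.lean`. [cite: Kollar2007, Thm. 3.27] -/
theorem resolution_input {k : Type} [Field k] [CharZero k]
    (X : Literature.AlgebraicGeometry.Motives.SchemeOver k) [AlgebraicGeometry.IsIntegral X.left]
    (hX : Literature.AlgebraicGeometry.Motives.IsProjectiveOver X) :
    ∃ (Y : AlgebraicGeometry.Scheme) (ρ : Y ⟶ X.left),
      Literature.AlgebraicGeometry.Resolution.IsResolution ρ ∧
        Literature.AlgebraicGeometry.Motives.IsProjectiveOver (Over.mk (ρ ≫ X.hom)) :=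
  Literature.AlgebraicGeometry.Resolution.exists_isResolution_isProjectiveOver_of_isProjectiveOver X hX

/-- Proper morphisms are proper on real points, PROVED in
`Literature/AlgebraicGeometry/Motives/AlgPointsProperMapProofs.lean`. [cite: SGA1, Exp. XII Prop. 3.2 (v)] -/
theorem properness_input {k : Type} [Field k] [Algebra k ℝ]
    {X S : Literature.AlgebraicGeometry.Motives.SchemeOver k} (f : X ⟶ S)
    [AlgebraicGeometry.UniversallyClosed f.left] [AlgebraicGeometry.QuasiCompact f.left] :
    IsProperMap (Literature.AlgebraicGeometry.Motives.AlgPoints.map (L := ℝ) f) :=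
  Literature.AlgebraicGeometry.Motives.AlgPoints.isProperMap_map f

end Summit.KontsevichZagierPeriods.KontsevichZagierPeriods.Cruxes.CubeResolution.IdeateR1K2
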